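import Mathlib.Algebra.MvPolynomial.PDeriv
import Mathlib.LinearAlgebra.Matrix.Transvection
import Mathlib.LinearAlgebra.Matrix.NonsingularInverse
import Mathlib.LinearAlgebra.FiniteDimensional.Lemmas
import Mathlib.RingTheory.MvPolynomial.Basic
import Mathlib.RingTheory.MvPolynomial.Homogeneous
import Mathlib.Algebra.Order.Antidiag.FinsuppEquiv
import Mathlib.Data.Set.Finite.List
import Literature.Barriers.ValiantsHypothesis.ShiftedPartialDerivatives
import Literature.Computability.AlgebraicComplexity.LinSubst
import HarnessLib

/-!
# Shifted partial derivatives: ranks do not increase under linear substitution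
(Efremenko–Landsberg–Schenck–Weyman 2018, §1.1)

Support file for the barrier entry `ShiftedPartialDerivatives.lean` (ELSW Thm. 1.5,
`ShiftedPartialsCannotSeparate`). ELSW §1.1 (checked with `lit read`, arXiv:1609.02103 p. 3):
"Given polynomials `P, Q ∈ S^nW`, and `k < n`, `P ∈ End(W)·Q` implies that
`rank(P_{k,n-k}) ≤ rank(Q_{k,n-k})`. [...] Again `P ∈ End(W)·Q` implies that
`rank(P_{(k,n-k)[τ]}) ≤ rank(Q_{(k,n-k)[τ]})`." This monotonicity is what makes the method of
shifted partial derivatives a lower-bound method, and it is the tool by which ELSW compare the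
padded permanent with DEGENERATIONS `R ∈ End(W)·det_n` of the determinant (§3, Case C1: a
block-diagonal restriction; §5, Case C3: `R = ℓ₁ⁿ + ℓ₂ⁿ`).

**What is proved** (every field `K`, finite variable type `σ`, all `k, τ`, no degree or
homogeneity hypothesis): for every square matrix `A`,
`shiftedPartialsRank K k τ (linSubst σ K A p) ≤ shiftedPartialsRank K k τ p`
(`shiftedPartialsRank_linSubst_le`; `linSubst σ K A : X i ↦ ∑ j, A j i • X j` is the tree's
linear substitution action, `LinSubst.lean`), hence `shiftedPartialsRank_le_of_mem_endOrbit`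
for the endomorphism orbit `endOrbit σ K f = End(K^σ) · f`.

**Proof** (the printed sentence has no proof; the following standard argument is formalised).
(1) Chain rule `∂_j (A·p) = ∑ i, A j i • A·(∂_i p)` (`pderiv_linSubst`), so every `k`-th
derivative of `A·p` is a combination of the `A·(∂_I p)`, `|I| = k`
(`iterPDeriv_linSubst_mem_span`). (2) For invertible `A` the degree-`τ` monomials are the
`A`-images of degree-`τ` forms, so the shifted-partials span of `A·p` lies in the `A`-image of
that of `p` and the rank does not increase (`shiftedPartialsRank_linSubst_le_of_mul_eq_one`).
(3) For the substitution killing one variable `X i₀ ↦ 0` (the diagonal `0/1` matrix with `0` at `i₀`;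
lemmas `*_kill_*`), the `k`-th derivatives
of the specialisation are specialisations of `k`-th derivatives
(`iterPDeriv_linSubst_kill`), and a filtration argument in the `X i₀`-degree (the slices
`weightedHomogeneousComponent (Pi.single i₀ 1) d` = terms of exact `X i₀`-degree `d`, lemmas
`*_slice_*`; the submodules `restrictSupport K {β | d ≤ β i₀}` of polynomials of `X i₀`-order `≥ d`,
lemmas `*_orderFiltration_*`; rank–nullity summed over `d`: `finrank_telescope`) bounds the rank of the specialisation by that of `p`
(`shiftedPartialsRank_linSubst_kill_le`). (4) Every matrix is
`(transvections) · diagonal · (transvections)` (Mathlib's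
`Matrix.Pivot.exists_list_transvec_mul_diagonal_mul_list_transvec`), and a diagonal matrix is an
invertible diagonal matrix times a product of one-variable kills
(`shiftedPartialsRank_linSubst_diagonal01_le`).

**Not here.** The persistence of the inequality on the Zariski CLOSURE of the orbit
(semicontinuity; the tree's named fact `shiftedPartialsRank_le_of_mem_orbitClosure`) is not
proved in this file; only the `End(W)`-orbit statement printed in §1.1 is.

## References

* [EfremenkoLandsbergSchenckWeyman2018] K. Efremenko, J. M. Landsberg, H. Schenck, J. Weyman,
  *The method of shifted partial derivatives cannot separate the permanent from the
  determinant*, Math. Comp. 87 (2018) 2037–2045, §1.1.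
-/

noncomputable section

namespace Literature.Barriers.ValiantsHypothesis

open Literature.Computability.AlgebraicComplexity MvPolynomial

section Finite

variable {R : Type*} [CommSemiring R] {σ : Type*}

/-- A monomial exponent has degree `τ` iff it lies in Mathlib's `finsuppAntidiag univ τ`. [folklore] -/
theorem degree_eq_iff_mem_finsuppAntidiag [Fintype σ] [DecidableEq σ] (β : σ →₀ ℕ) (τ : ℕ) :
    β.degree = τ ↔ β ∈ (Finset.univ : Finset σ).finsuppAntidiag τ := by
  rw [Finset.mem_finsuppAntidiag, Finsupp.degree_eq_sum]
  simp

/-- For finitely many variables the set of shifted partials of order `k` and shift `τ` is finite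
(finitely many derivative lists and finitely many monomials of degree `τ`). [folklore] -/
theorem shiftedPartials_finite [Finite σ] (k τ : ℕ) (f : MvPolynomial σ R) :
    (shiftedPartials k τ f).Finite := by
  classical
  haveI : Fintype σ := Fintype.ofFinite σ
  have h1 : {l : List σ | l.length = k}.Finite := List.finite_length_eq σ k
  have h2 : {β : σ →₀ ℕ | β.degree = τ}.Finite := by
    refine (Finset.finite_toSet ((Finset.univ : Finset σ).finsuppAntidiag τ)).subset ?_
    intro β hβ
    exact (degree_eq_iff_mem_finsuppAntidiag β τ).1 hβ
  refine ((h1.prod h2).image fun lb => monomial lb.2 (1 : R) * iterPDeriv lb.1 f).subset ?_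
  rintro h ⟨l, β, hl, hβ, rfl⟩
  exact ⟨(l, β), ⟨hl, hβ⟩, rfl⟩

/-- Hence the span of the shifted partials is finite-dimensional, so that `shiftedPartialsRank`
(a `finrank`) is a genuine dimension (use with `haveI`). [folklore] -/
theorem finite_span_shiftedPartials {K : Type*} [Field K] [Finite σ] (k τ : ℕ)
    (f : MvPolynomial σ K) : Module.Finite K (Submodule.span K (shiftedPartials k τ f)) :=
  Module.Finite.span_of_finite K (shiftedPartials_finite k τ f)

end Finite

section ChainRule

variable {K : Type*} [Field K] {σ : Type*} [Fintype σ] [DecidableEq σ]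

/-- **Chain rule** for the linear substitution `X i ↦ ∑ j, A j i • X j`:
`∂_j (A · p) = ∑ i, A j i • A · (∂_i p)`. [folklore] -/
theorem pderiv_linSubst (A : Matrix σ σ K) (j : σ) (p : MvPolynomial σ K) :
    pderiv j (linSubst σ K A p) = ∑ i, A j i • linSubst σ K A (pderiv i p) := by
  induction p using MvPolynomial.induction_on with
  | C a => simp
  | add p q hp hq => simp only [map_add, hp, hq, smul_add, Finset.sum_add_distrib]
  | mul_X p i hp =>
    have hX : pderiv j (linSubst σ K A (X i)) = (A j i) • (1 : MvPolynomial σ K) := by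
      rw [linSubst_X, map_sum]
      have h' : ∀ x, pderiv j (A x i • (X x : MvPolynomial σ K)) = A x i • pderiv j (X x) :=
        fun x => Derivation.map_smul _ _ _
      simp_rw [h', pderiv_X]
      simp [Pi.single_apply, Finset.sum_ite_eq']
    rw [map_mul, pderiv_mul, hp, hX, Finset.sum_mul]
    simp_rw [pderiv_mul, map_add, map_mul, smul_add, Finset.sum_add_distrib]
    congr 1
    · exact Finset.sum_congr rfl fun x _ => smul_mul_assoc _ _ _
    · simp only [pderiv_X, Pi.single_apply]
      have h1 : ∀ x : σ, linSubst σ K A (if i = x then 1 else 0) =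
          if i = x then (1 : MvPolynomial σ K) else 0 := fun x => by
        split_ifs <;> simp
      simp only [h1, mul_ite, mul_one, mul_zero, smul_ite, smul_zero, Finset.sum_ite_eq,
        Finset.mem_univ, if_true]
      rw [mul_smul_comm, mul_one]

/-- Every iterated derivative of `A · p` along a list of length `k` is a linear combination of the
substituted iterated derivatives `A · (∂_{l'} p)`, `|l'| = k` (iterate the chain rule). [folklore] -/
theorem iterPDeriv_linSubst_mem_span (A : Matrix σ σ K) (l : List σ) (p : MvPolynomial σ K) :
    iterPDeriv l (linSubst σ K A p) ∈ Submodule.span K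
      {q | ∃ l' : List σ, l'.length = l.length ∧ q = linSubst σ K A (iterPDeriv l' p)} := by
  induction l with
  | nil => exact Submodule.subset_span ⟨[], rfl, rfl⟩
  | cons j l ih =>
    rw [iterPDeriv_cons]
    have : Submodule.span K {q | ∃ l' : List σ, l'.length = l.length ∧
        q = linSubst σ K A (iterPDeriv l' p)} ≤
        (Submodule.span K {q | ∃ l' : List σ, l'.length = (j :: l).length ∧
          q = linSubst σ K A (iterPDeriv l' p)}).comap (pderiv j).toLinearMap := by
      rw [Submodule.span_le]
      rintro q ⟨l', hl', rfl⟩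
      simp only [Submodule.mem_comap, SetLike.mem_coe]
      change pderiv j (linSubst σ K A (iterPDeriv l' p)) ∈ _
      rw [pderiv_linSubst]
      refine Submodule.sum_mem _ fun i _ => Submodule.smul_mem _ _ (Submodule.subset_span ?_)
      exact ⟨i :: l', by simp [hl'], by rw [iterPDeriv_cons]⟩
    exact this ih

end ChainRule


section Invertible

variable {K : Type*} [Field K] {σ : Type*} [Fintype σ] [DecidableEq σ]

omit [Fintype σ] [DecidableEq σ] in
/-- A form of degree `τ` is a linear combination of the monomials of degree `τ`. [folklore] -/
theorem mem_span_monomial_of_isHomogeneous {q : MvPolynomial σ K} {τ : ℕ}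
    (hq : q.IsHomogeneous τ) :
    q ∈ Submodule.span K {m | ∃ β : σ →₀ ℕ, β.degree = τ ∧ m = monomial β (1 : K)} := by
  rw [q.as_sum]
  refine Submodule.sum_mem _ fun β hβ => ?_
  have hdeg : β.degree = τ := by
    have := hq (mem_support_iff.1 hβ)
    rwa [Finsupp.degree_eq_weight_one]
  have : monomial β (coeff β q) = coeff β q • monomial β (1 : K) := by
    rw [smul_monomial, smul_eq_mul, mul_one]
  rw [this]
  exact Submodule.smul_mem _ _ (Submodule.subset_span ⟨β, hdeg, rfl⟩)

/-- For `A` invertible (`A * B = 1`) the span of the shifted partials of `A · p` lies in the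
`A`-image of the span of the shifted partials of `p`: the degree-`τ` monomials are `A`-images of
degree-`τ` forms (`x^β = A·(B·x^β)`), and `k`-th derivatives of `A·p` are combinations of
`A·(∂_I p)`. ELSW §1.1 (the `GL(W)`-equivariance of the flattening maps). [cite: EfremenkoLandsbergSchenckWeyman2018, §1.1] -/
theorem span_shiftedPartials_linSubst_le_map {A B : Matrix σ σ K} (hAB : A * B = 1) (k τ : ℕ)
    (p : MvPolynomial σ K) :
    Submodule.span K (shiftedPartials k τ (linSubst σ K A p)) ≤
      (Submodule.span K (shiftedPartials k τ p)).map (linSubst σ K A).toLinearMap := by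
  rw [Submodule.span_le]
  rintro h ⟨l, β, hl, hβ, rfl⟩
  have key : Submodule.span K
      {q | ∃ l' : List σ, l'.length = l.length ∧ q = linSubst σ K A (iterPDeriv l' p)} ≤
      ((Submodule.span K (shiftedPartials k τ p)).map (linSubst σ K A).toLinearMap).comap
        (LinearMap.mulLeft K (monomial β (1 : K))) := by
    rw [Submodule.span_le]
    rintro q ⟨l', hl', rfl⟩
    simp only [SetLike.mem_coe, Submodule.mem_comap, LinearMap.mulLeft_apply]
    have hq0 : (linSubst σ K B (monomial β (1 : K))).IsHomogeneous τ :=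
      linSubst_isHomogeneous B (isHomogeneous_monomial _ hβ)
    have hLL : linSubst σ K A (linSubst σ K B (monomial β (1 : K))) = monomial β 1 := by
      rw [← AlgHom.comp_apply, ← linSubst_mul, hAB, linSubst_one]; rfl
    rw [← hLL, ← map_mul]
    refine Submodule.mem_map_of_mem ?_
    have hsub : Submodule.span K {m | ∃ γ : σ →₀ ℕ, γ.degree = τ ∧ m = monomial γ (1 : K)} ≤
        (Submodule.span K (shiftedPartials k τ p)).comap
          (LinearMap.mulRight K (iterPDeriv l' p)) := by
      rw [Submodule.span_le]
      rintro m ⟨γ, hγ, rfl⟩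
      simp only [SetLike.mem_coe, Submodule.mem_comap, LinearMap.mulRight_apply]
      exact Submodule.subset_span ⟨l', γ, hl'.trans hl, hγ, rfl⟩
    exact hsub (mem_span_monomial_of_isHomogeneous hq0)
  exact key (iterPDeriv_linSubst_mem_span A l p)

/-- Invertible substitutions do not increase shifted-partials ranks (hence preserve them, applying
the lemma to the inverse). [cite: EfremenkoLandsbergSchenckWeyman2018, §1.1] -/
theorem shiftedPartialsRank_linSubst_le_of_mul_eq_one {A B : Matrix σ σ K} (hAB : A * B = 1)
    (k τ : ℕ) (p : MvPolynomial σ K) :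
    shiftedPartialsRank K k τ (linSubst σ K A p) ≤ shiftedPartialsRank K k τ p := by
  unfold shiftedPartialsRank
  haveI := finite_span_shiftedPartials (K := K) k τ p
  exact (Submodule.finrank_mono (span_shiftedPartials_linSubst_le_map hAB k τ p)).trans
    (Submodule.finrank_map_le _ _)

end Invertible

section Kill

variable {K : Type*} [Field K] {σ : Type*}

/-- The ORDER FILTRATION in `X i₀`: membership in `restrictSupport K {β | d ≤ β i₀}` means every
monomial in the support has `X i₀`-degree `≥ d`. [folklore] -/
theorem mem_orderFiltration_iff {i₀ : σ} {d : ℕ} {p : MvPolynomial σ K} :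
    p ∈ restrictSupport K {β : σ →₀ ℕ | d ≤ β i₀} ↔ ∀ β, coeff β p ≠ 0 → d ≤ β i₀ := by
  rw [mem_restrictSupport_iff]
  simp only [Set.subset_def, Finset.mem_coe, mem_support_iff, Set.mem_setOf_eq]

/-- The order filtration is decreasing in `d`. [folklore] -/
theorem orderFiltration_antitone (i₀ : σ) {d e : ℕ} (h : d ≤ e) : restrictSupport K {β : σ →₀ ℕ | e ≤ β i₀} ≤ restrictSupport K {β : σ →₀ ℕ | d ≤ β i₀} :=
  restrictSupport_mono K fun (β : σ →₀ ℕ) (hβ : e ≤ β i₀) => h.trans hβ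

/-- Order `≥ 0` is no condition. [folklore] -/
theorem orderFiltration_zero (i₀ : σ) : restrictSupport K {β : σ →₀ ℕ | 0 ≤ β i₀} = ⊤ :=
  eq_top_iff.2 fun _ _ => mem_orderFiltration_iff.2 fun _ _ => Nat.zero_le _

variable [DecidableEq σ]

/-- The SLICE of exact `X i₀`-degree `d` is Mathlib's `weightedHomogeneousComponent` for the weight
`Pi.single i₀ 1`; its coefficients are those of `p` in `X i₀`-degree `d` and zero otherwise. [folklore] -/
theorem coeff_slice (i₀ : σ) (d : ℕ) (p : MvPolynomial σ K) (β : σ →₀ ℕ) :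
    coeff β (weightedHomogeneousComponent (Pi.single i₀ 1 : σ → ℕ) d p) = if β i₀ = d then coeff β p else 0 := by
  rw [coeff_weightedHomogeneousComponent, Finsupp.weight_single_one_apply]

/-- The `d`-th slice kills polynomials of `X i₀`-order `≥ d + 1`. [folklore] -/
theorem slice_eq_zero_of_mem_orderFiltration {i₀ : σ} {d : ℕ} {p : MvPolynomial σ K}
    (hp : p ∈ restrictSupport K {β : σ →₀ ℕ | d + 1 ≤ β i₀}) : weightedHomogeneousComponent (Pi.single i₀ 1 : σ → ℕ) d p = 0 := by
  rw [mem_orderFiltration_iff] at hp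
  ext β
  rw [coeff_slice, coeff_zero]
  split_ifs with h
  · by_contra hne
    have := hp β hne
    omega
  · rfl

omit [DecidableEq σ] in
/-- `x^γ · q` has `X i₀`-order at least `γ i₀`. [folklore] -/
theorem monomial_mul_mem_orderFiltration (i₀ : σ) (γ : σ →₀ ℕ) (q : MvPolynomial σ K) :
    monomial γ (1 : K) * q ∈ restrictSupport K {β : σ →₀ ℕ | γ i₀ ≤ β i₀} := by
  rw [mem_orderFiltration_iff]
  intro β hβ
  rw [coeff_monomial_mul'] at hβ
  split_ifs at hβ with hle
  · exact hle i₀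
  · exact (hβ rfl).elim

/-- The `γ i₀`-th slice of `x^γ · q` is `x^γ` times the `X i₀`-free part of `q`. [folklore] -/
theorem slice_monomial_mul (i₀ : σ) (γ : σ →₀ ℕ) (q : MvPolynomial σ K) :
    weightedHomogeneousComponent (Pi.single i₀ 1 : σ → ℕ) (γ i₀) (monomial γ (1 : K) * q) = monomial γ 1 * weightedHomogeneousComponent (Pi.single i₀ 1 : σ → ℕ) 0 q := by
  ext β
  rw [coeff_slice, coeff_monomial_mul', coeff_monomial_mul', coeff_slice]
  by_cases hle : γ ≤ β
  · rw [if_pos hle, if_pos hle]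
    have h1 : (β - γ) i₀ = β i₀ - γ i₀ := rfl
    have h2 := hle i₀
    by_cases hβ : β i₀ = γ i₀
    · rw [if_pos hβ, if_pos (by rw [h1]; omega)]
    · rw [if_neg hβ, if_neg (by rw [h1]; omega), mul_zero]
  · rw [if_neg hle, if_neg hle]; split_ifs <;> rfl

variable [Fintype σ]

/-- The KILL substitution: `linSubst` by the diagonal matrix with `0` at `i₀` and `1` elsewhere sends
`X i₀ ↦ 0` and fixes the other variables. [folklore] -/
theorem linSubst_kill_X (i₀ j : σ) :
    linSubst σ K (Matrix.diagonal fun j => if j = i₀ then (0 : K) else 1) (X j) = if j = i₀ then 0 else X j := by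
  rw [linSubst_X]
  simp only [Matrix.diagonal_apply, ite_smul, zero_smul, Finset.sum_ite_eq', Finset.mem_univ,
    if_true]
  split_ifs <;> simp

/-- Killing `X i₀` keeps exactly the `X i₀`-free part of a polynomial (its `0`-th slice). [folklore] -/
theorem linSubst_kill_eq_slice_zero (i₀ : σ) (p : MvPolynomial σ K) :
    linSubst σ K (Matrix.diagonal fun j => if j = i₀ then (0 : K) else 1) p = weightedHomogeneousComponent (Pi.single i₀ 1 : σ → ℕ) 0 p := by
  induction p using MvPolynomial.induction_on' with
  | add p q hp hq => rw [map_add, map_add, hp, hq]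
  | monomial β a =>
    have hL : linSubst σ K (Matrix.diagonal fun j => if j = i₀ then (0 : K) else 1) (monomial β a) =
        if β i₀ = 0 then monomial β a else 0 := by
      rw [linSubst, aeval_monomial, Finsupp.prod]
      by_cases h0 : β i₀ = 0
      · rw [if_pos h0]
        have : ∏ i ∈ β.support, (∑ j, (Matrix.diagonal fun j => if j = i₀ then (0 : K) else 1) j i • (X j : MvPolynomial σ K)) ^ β i =
            ∏ i ∈ β.support, (X i : MvPolynomial σ K) ^ β i := by
          refine Finset.prod_congr rfl fun i hi => ?_
          have hne : i ≠ i₀ := by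
            rintro rfl; exact (Finsupp.mem_support_iff.1 hi) h0
          rw [← linSubst_X, linSubst_kill_X, if_neg hne]
        rw [this, prod_X_pow_eq_monomial, algebraMap_eq, C_mul_monomial, mul_one]
      · rw [if_neg h0]
        have hi : i₀ ∈ β.support := Finsupp.mem_support_iff.2 h0
        rw [Finset.prod_eq_zero hi, mul_zero]
        rw [← linSubst_X, linSubst_kill_X, if_pos rfl, zero_pow h0]
    rw [hL]
    ext γ
    rw [coeff_slice, coeff_monomial]
    by_cases h0 : β i₀ = 0
    · rw [if_pos h0, coeff_monomial]
      by_cases hγ : γ i₀ = 0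
      · rw [if_pos hγ]
      · rw [if_neg hγ, if_neg]
        rintro rfl
        exact hγ h0
    · rw [if_neg h0, coeff_zero]
      by_cases hγ : γ i₀ = 0
      · rw [if_pos hγ, if_neg]
        rintro rfl
        exact h0 hγ
      · rw [if_neg hγ]

/-- Derivatives of the specialisation `X i₀ ↦ 0`: `∂_j (p|_{X i₀ = 0}) = (∂_j p)|_{X i₀ = 0}` for
`j ≠ i₀`, and `∂_{i₀}` of it vanishes. [folklore] -/
theorem pderiv_linSubst_kill (i₀ j : σ) (p : MvPolynomial σ K) :
    pderiv j (linSubst σ K (Matrix.diagonal fun j => if j = i₀ then (0 : K) else 1) p) =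
      if j = i₀ then 0 else linSubst σ K (Matrix.diagonal fun j => if j = i₀ then (0 : K) else 1) (pderiv j p) := by
  rw [pderiv_linSubst]
  simp only [Matrix.diagonal_apply, ite_smul, zero_smul, one_smul,
    Finset.sum_ite_eq, Finset.mem_univ, if_true]

/-- Iterated derivatives of the specialisation `X i₀ ↦ 0` are specialisations of iterated
derivatives (or zero if `X i₀` is differentiated). [folklore] -/
theorem iterPDeriv_linSubst_kill (i₀ : σ) (l : List σ) (p : MvPolynomial σ K) :
    iterPDeriv l (linSubst σ K (Matrix.diagonal fun j => if j = i₀ then (0 : K) else 1) p) =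
      if i₀ ∈ l then 0 else linSubst σ K (Matrix.diagonal fun j => if j = i₀ then (0 : K) else 1) (iterPDeriv l p) := by
  induction l with
  | nil => simp
  | cons j l ih =>
    rw [iterPDeriv_cons, ih]
    by_cases hl : i₀ ∈ l
    · rw [if_pos hl, map_zero, if_pos (List.mem_cons_of_mem j hl)]
    · rw [if_neg hl, pderiv_linSubst_kill]
      by_cases hj : j = i₀
      · subst hj; rw [if_pos rfl, if_pos List.mem_cons_self]
      · rw [if_neg hj, iterPDeriv_cons, if_neg]
        simp [hl, Ne.symm hj]

end Kill


section KillRank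

variable {K : Type*} [Field K]

/-- The dimension of a finite supremum of finite-dimensional subspaces is at most the sum of their
dimensions. [folklore] -/
theorem finrank_finset_sup_le_sum {V : Type*} [AddCommGroup V] [Module K V] {ι : Type*}
    (s : Finset ι) (W : ι → Submodule K V) [∀ i, Module.Finite K (W i)] :
    Module.finrank K ↥(s.sup W) ≤ ∑ i ∈ s, Module.finrank K (W i) := by
  classical
  induction s using Finset.induction_on with
  | empty => simp
  | insert i s hi ih =>
    rw [Finset.sup_insert, Finset.sum_insert hi]
    exact (Submodule.finrank_add_le_finrank_add_finrank _ _).trans (Nat.add_le_add_left ih _)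

/-- **Filtration count.** For a finite-dimensional subspace `U`, a decreasing filtration `I d` and
linear maps `f d` killing `U ⊓ I (d+1)`: `∑_{d<D} dim f_d(U ⊓ I d) + dim (U ⊓ I D) ≤ dim (U ⊓ I 0)`
(rank–nullity for `f d` restricted to `U ⊓ I d`, whose kernel contains `U ⊓ I (d+1)`, summed over
`d`). [folklore] -/
theorem finrank_telescope {V : Type*} [AddCommGroup V] [Module K V]
    (U : Submodule K V) [Module.Finite K U] (I : ℕ → Submodule K V) (hI : ∀ d, I (d + 1) ≤ I d)
    (f : ℕ → V →ₗ[K] V) (hf : ∀ d, ∀ u ∈ U ⊓ I (d + 1), f d u = 0) (D : ℕ) :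
    ∑ d ∈ Finset.range D, Module.finrank K ↥((U ⊓ I d).map (f d)) +
      Module.finrank K ↥(U ⊓ I D) ≤ Module.finrank K ↥(U ⊓ I 0) := by
  induction D with
  | zero => simp
  | succ D ih =>
    rw [Finset.sum_range_succ]
    have hle : U ⊓ I (D + 1) ≤ U ⊓ I D := inf_le_inf_left _ (hI D)
    have hrn := LinearMap.finrank_range_add_finrank_ker ((f D).domRestrict (U ⊓ I D))
    rw [LinearMap.range_domRestrict] at hrn
    have hker : Module.finrank K ↥(U ⊓ I (D + 1)) ≤
        Module.finrank K (LinearMap.ker ((f D).domRestrict (U ⊓ I D))) := by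
      have hrange : LinearMap.range (Submodule.inclusion hle) ≤
          LinearMap.ker ((f D).domRestrict (U ⊓ I D)) := by
        rintro x ⟨y, rfl⟩
        rw [LinearMap.mem_ker, LinearMap.domRestrict_apply, Submodule.coe_inclusion]
        exact hf D y y.2
      calc Module.finrank K ↥(U ⊓ I (D + 1))
          = Module.finrank K (LinearMap.range (Submodule.inclusion hle)) :=
            (LinearMap.finrank_range_of_inj (Submodule.inclusion_injective hle)).symm
        _ ≤ _ := Submodule.finrank_mono hrange
    omega

variable {σ : Type*} [Fintype σ] [DecidableEq σ]

/-- **Specialising one variable to `0` does not increase shifted-partials ranks.** With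
`U = span (shiftedPartials k τ p)`: the shifted partials of `p|_{X i₀=0}` lie in
`⨆_{d ≤ τ} W_d`, `W_d = span {x^β · (∂_l p)|_{X i₀ = 0} : β i₀ = d}` (`iterPDeriv_linSubst_kill`),
and `W_d` lies in the `d`-th slice of `U ⊓ I_d`, `I_d` = polynomials of `X i₀`-order `≥ d`
(`slice_monomial_mul`), so `rank ≤ ∑_d dim W_d ≤ ∑_d dim slice_d (U ⊓ I_d) ≤ dim U`
(`finrank_telescope`). This is the special case "`A` = kill `X i₀`" of ELSW §1.1 "`P ∈ End(W)·Q` implies `rank P_{(k,n-k)[τ]} ≤ rank Q_{(k,n-k)[τ]}`". [cite: EfremenkoLandsbergSchenckWeyman2018, §1.1] -/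
theorem shiftedPartialsRank_linSubst_kill_le (i₀ : σ) (k τ : ℕ) (p : MvPolynomial σ K) :
    shiftedPartialsRank K k τ (linSubst σ K (Matrix.diagonal fun j => if j = i₀ then (0 : K) else 1) p) ≤ shiftedPartialsRank K k τ p := by
  set U := Submodule.span K (shiftedPartials k τ p) with hU
  haveI hUfin : Module.Finite K U := finite_span_shiftedPartials (K := K) k τ p
  set W : ℕ → Submodule K (MvPolynomial σ K) := fun d => Submodule.span K
    {h | ∃ (l : List σ) (β : σ →₀ ℕ), l.length = k ∧ β.degree = τ ∧ β i₀ = d ∧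
      h = monomial β (1 : K) * weightedHomogeneousComponent (Pi.single i₀ 1 : σ → ℕ) 0 (iterPDeriv l p)} with hW
  have h1 : Submodule.span K (shiftedPartials k τ (linSubst σ K (Matrix.diagonal fun j => if j = i₀ then (0 : K) else 1) p)) ≤
      (Finset.range (τ + 1)).sup W := by
    rw [Submodule.span_le]
    rintro h ⟨l, β, hl, hβ, rfl⟩
    rw [iterPDeriv_linSubst_kill]
    split_ifs with hmem
    · simp
    · rw [linSubst_kill_eq_slice_zero]
      have hd : β i₀ ≤ τ := hβ ▸ Finsupp.le_degree i₀ β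
      have : W (β i₀) ≤ (Finset.range (τ + 1)).sup W :=
        Finset.le_sup (f := W) (Finset.mem_range.2 (Nat.lt_succ_of_le hd))
      exact this (Submodule.subset_span ⟨l, β, hl, hβ, rfl, rfl⟩)
  have h2 : ∀ d, W d ≤ (U ⊓ restrictSupport K {β : σ →₀ ℕ | d ≤ β i₀}).map (weightedHomogeneousComponent (Pi.single i₀ 1 : σ → ℕ) d) := by
    intro d
    rw [Submodule.span_le]
    rintro h ⟨l, β, hl, hβ, hβd, rfl⟩
    refine ⟨monomial β 1 * iterPDeriv l p, ⟨Submodule.subset_span ⟨l, β, hl, hβ, rfl⟩, ?_⟩, ?_⟩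
    · have := monomial_mul_mem_orderFiltration (K := K) i₀ β (iterPDeriv l p)
      rwa [hβd] at this
    · change weightedHomogeneousComponent (Pi.single i₀ 1 : σ → ℕ) d (monomial β 1 * iterPDeriv l p) = _
      rw [← hβd, slice_monomial_mul]
  haveI h3 : ∀ d, Module.Finite K (W d) := fun d =>
    Submodule.finiteDimensional_of_le (h2 d)
  have h4 := finrank_telescope U (fun d => restrictSupport K {β : σ →₀ ℕ | d ≤ β i₀}) (fun d => orderFiltration_antitone i₀ (Nat.le_succ d))
    (fun d => weightedHomogeneousComponent (Pi.single i₀ 1 : σ → ℕ) d) (fun d u hu => slice_eq_zero_of_mem_orderFiltration hu.2) (τ + 1)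
  have h5 := finrank_finset_sup_le_sum (K := K) (Finset.range (τ + 1)) W
  have h6 : ∑ d ∈ Finset.range (τ + 1), Module.finrank K (W d) ≤
      ∑ d ∈ Finset.range (τ + 1), Module.finrank K ↥((U ⊓ restrictSupport K {β : σ →₀ ℕ | d ≤ β i₀}).map (weightedHomogeneousComponent (Pi.single i₀ 1 : σ → ℕ) d)) :=
    Finset.sum_le_sum fun d _ => Submodule.finrank_mono (h2 d)
  have h7 : Module.finrank K ↥(U ⊓ restrictSupport K {β : σ →₀ ℕ | 0 ≤ β i₀}) = Module.finrank K U := by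
    rw [orderFiltration_zero, inf_top_eq]
  calc shiftedPartialsRank K k τ (linSubst σ K (Matrix.diagonal fun j => if j = i₀ then (0 : K) else 1) p)
      ≤ Module.finrank K ↥((Finset.range (τ + 1)).sup W) := Submodule.finrank_mono h1
    _ ≤ Module.finrank K U := by omega

end KillRank


section General

variable {K : Type*} [Field K] {σ : Type*} [Fintype σ] [DecidableEq σ]

/-- Specialising a set `S` of variables to `0` (the `0/1` diagonal substitution) does not increase
shifted-partials ranks (iterate `shiftedPartialsRank_linSubst_kill_le`). [cite: EfremenkoLandsbergSchenckWeyman2018, §1.1] -/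
theorem shiftedPartialsRank_linSubst_diagonal01_le (S : Finset σ) (k τ : ℕ)
    (p : MvPolynomial σ K) :
    shiftedPartialsRank K k τ
        (linSubst σ K (Matrix.diagonal fun j => if j ∈ S then (0 : K) else 1) p) ≤
      shiftedPartialsRank K k τ p := by
  induction S using Finset.induction_on generalizing p with
  | empty =>
    have : (Matrix.diagonal fun j : σ => if j ∈ (∅ : Finset σ) then (0 : K) else 1) = 1 := by
      simp
    rw [this, linSubst_one]
    exact le_rfl
  | insert i S hi ih =>
    have hmat : (Matrix.diagonal fun j => if j ∈ insert i S then (0 : K) else 1) =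
        (Matrix.diagonal fun j => if j = i then (0 : K) else 1) * Matrix.diagonal fun j => if j ∈ S then (0 : K) else 1 := by
      rw [Matrix.diagonal_mul_diagonal]
      congr 1
      ext j
      by_cases hj : j = i
      · subst hj; simp
      · simp [hj, Finset.mem_insert]
    rw [hmat, linSubst_mul, AlgHom.comp_apply]
    exact (shiftedPartialsRank_linSubst_kill_le i k τ _).trans (ih _)

/-- **ELSW §1.1: "`P ∈ End(W)·Q` implies `rank(P_{(k,n-k)[τ]}) ≤ rank(Q_{(k,n-k)[τ]})`"** — for every
square matrix `A` (invertible or not), every order `k` and shift `τ`, the shifted-partials rank of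
the linear substitution `A · p` is at most that of `p`. Over any field, for polynomials of any
degree (the printed hypotheses "`P, Q ∈ S^nW`, `k < n`" are not needed for the inequality).
Proof: transvection factorisation `A = T · diagonal D · T'` (Mathlib), invertible factors by
`shiftedPartialsRank_linSubst_le_of_mul_eq_one`, the `0/1` part of the diagonal by
`shiftedPartialsRank_linSubst_diagonal01_le`. [cite: EfremenkoLandsbergSchenckWeyman2018, §1.1] -/
theorem shiftedPartialsRank_linSubst_le (A : Matrix σ σ K) (k τ : ℕ) (p : MvPolynomial σ K) :
    shiftedPartialsRank K k τ (linSubst σ K A p) ≤ shiftedPartialsRank K k τ p := by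
  classical
  obtain ⟨L, L', D, hA⟩ := Matrix.Pivot.exists_list_transvec_mul_diagonal_mul_list_transvec A
  set T := (L.map Matrix.TransvectionStruct.toMatrix).prod with hT
  set T' := (L'.map Matrix.TransvectionStruct.toMatrix).prod with hT'
  set D₁ : σ → K := fun i => if D i = 0 then 1 else D i with hD₁
  set S : Finset σ := Finset.univ.filter fun i => D i = 0 with hS
  have hD : Matrix.diagonal D =
      Matrix.diagonal D₁ * Matrix.diagonal fun j => if j ∈ S then (0 : K) else 1 := by
    rw [Matrix.diagonal_mul_diagonal]
    congr 1
    ext j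
    by_cases h : D j = 0 <;> simp [hD₁, hS, h]
  have hTu : IsUnit T.det := by
    rw [hT, Matrix.TransvectionStruct.det_toMatrix_prod]; exact isUnit_one
  have hTu' : IsUnit T'.det := by
    rw [hT', Matrix.TransvectionStruct.det_toMatrix_prod]; exact isUnit_one
  have hD₁u : IsUnit (Matrix.diagonal D₁).det := by
    rw [Matrix.det_diagonal, isUnit_iff_ne_zero, Finset.prod_ne_zero_iff]
    intro i _
    by_cases h : D i = 0 <;> simp [hD₁, h]
  rw [hA, hD, linSubst_mul, linSubst_mul, linSubst_mul]
  simp only [AlgHom.comp_apply]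
  calc shiftedPartialsRank K k τ (linSubst σ K T (linSubst σ K (Matrix.diagonal D₁)
          (linSubst σ K (Matrix.diagonal fun j => if j ∈ S then (0 : K) else 1)
            (linSubst σ K T' p))))
      ≤ shiftedPartialsRank K k τ (linSubst σ K (Matrix.diagonal D₁)
          (linSubst σ K (Matrix.diagonal fun j => if j ∈ S then (0 : K) else 1)
            (linSubst σ K T' p))) :=
        shiftedPartialsRank_linSubst_le_of_mul_eq_one (Matrix.mul_nonsing_inv T hTu) _ _ _
    _ ≤ shiftedPartialsRank K k τ
          (linSubst σ K (Matrix.diagonal fun j => if j ∈ S then (0 : K) else 1)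
            (linSubst σ K T' p)) :=
        shiftedPartialsRank_linSubst_le_of_mul_eq_one (Matrix.mul_nonsing_inv _ hD₁u) _ _ _
    _ ≤ shiftedPartialsRank K k τ (linSubst σ K T' p) :=
        shiftedPartialsRank_linSubst_diagonal01_le S k τ _
    _ ≤ shiftedPartialsRank K k τ p :=
        shiftedPartialsRank_linSubst_le_of_mul_eq_one (Matrix.mul_nonsing_inv T' hTu') _ _ _

/-- Every `g ∈ End(K^σ) · f` (`endOrbit`, `LinSubst.lean`) has all shifted-partials ranks at most
those of `f` — the form in which ELSW use §1.1 in Cases C1 and C3 ("It will be sufficient to show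
that some `R ∈ End(W)·det_n` satisfies `rank((ℓ^{n-m}perm_m)_{(k,n-k)[τ]}) < rank(R_{(k,n-k)[τ]})`",
§3). [cite: EfremenkoLandsbergSchenckWeyman2018, §1.1 and §3] -/
theorem shiftedPartialsRank_le_of_mem_endOrbit {f g : MvPolynomial σ K} (hg : g ∈ endOrbit σ K f)
    (k τ : ℕ) : shiftedPartialsRank K k τ g ≤ shiftedPartialsRank K k τ f := by
  obtain ⟨A, rfl⟩ := hg
  exact shiftedPartialsRank_linSubst_le A k τ f

end General

end Literature.Barriers.ValiantsHypothesis
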